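import Literature.MathematicalPhysics.QuantumFieldTheory.Balaban1983to89.B11Eq98V0LettersPerLattice
import Literature.MathematicalPhysics.QuantumFieldTheory.Balaban1983to89.B11Eq44RegimePerLattice
import Literature.MathematicalPhysics.QuantumFieldTheory.Balaban1983to89.B11Eq90CurrentAtLetters

/-!
# `Balaban1983to89.B11Eq98WSlotSectCPerLattice` — T. Bałaban, *The variational problem and background fields in renormalization group method for
# lattice gauge theories*, Commun. Math. Phys. **102** (1985) 277–309 [Balaban1985Variational]: Prop. 3 p. 289, Prop. 4 (97)–(98) pp. 292–293,
# (80)–(90) pp. 290–291 — THE (L3) W-SLOT OF THE NE9 CHART AT THE T-SLOT's OWN `(H, C, ε_C)`, PER LATTICE: for every kernel `k_H`, the Sect. C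
# regime at `(HopAd … U k_H, Cc …)` AND the `Wq`-slot binders of `W = (δ/δA′)V` formed AT THAT regime's `ε_C` hold together, from the
# (31)-window and the trace ∕ unitarity structure alone

statement-level skeleton of published theorems with citation tags; proofs where landed; nothing here is a claim about the Yang–Mills mass gap

PDF held: `paper:balaban1985-cmp102-variational-background` (journal page = PDF page + 276); pp. 284–293 read by this seat in the held text layer
(p0009–p0017; 2026-08-21/22).

THE PRINT (verbatim, held text layer: p0013 = p. 289 L18–20, p0016 L32–35 and p0017 L1–6 = pp. 292–293).  p. 289, Prop. 3: *«The transformation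
(47) satisfying the identity (48), i.e. linearizing the averaging operation Q(LʲηA′), is defined and analytic for A′ satisfying (43) with ε₃
sufficiently small (e.g. 18C₂B₀dc₁(½)ε₃ ≤ 1, 2ε₃ ≤ c₄).»*  pp. 292–293, Prop. 4: *«The functional derivative of V(A′) is an analytic function on
this space, and satisfies the estimate |(δ/δA′)V| < C₄ε₃²(Lʲη)⁻³ on Ω_j, j = 0, 1, …, k. (97) The constants a₃, C₄ depend on d and L only. The
above estimate can be formulated also in the following way: |(δ/δA′)V(A′)|_{(−3)} ≤ C₄(max{|A′|_{(−1)}, |∇A′|_{(−2)}})², (98)»*.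
WHAT IS PROVED is NOT that uniformity: it is the PER-LATTICE conjunction of the two slots at one kernel's own regime.

WHY THIS FILE (cell context).  The (L3) W-slot theorems of this lineage — `B11Ineq73KernelLettersPerLattice.exists_quadAnalytic_W80` (θ) and
`B11Eq98V0LettersPerLattice.exists_quadAnalytic_W80_structural` (V₀-letters) — display the Sect. C data `RC : Regime H 0 C b 0 C₂ c₄ 0 a_C ε_C`,
`hC : Prop4Hyp C C₂ c₄`, `0 < a_C` at GENERIC `(H, C)`; `B11Eq44RegimePerLattice.exists_sectC_data` inhabits exactly these at the T-slot's
letters `(H, C) := (HopAd (L:ℝ) η levB lev₀ lev₁ U k_H, Cc L m η U lev₀ lev₁ (nabla115 η U) levB)` for ANY kernel `k_H` (ne9-leaf-03's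
`regime_sectC` ∕ `prop4Hyp_Cc` fed).  ne9-leaf-06 g56∕g57's binder-order remark (R-ne9leaf06-g56-1; (θ1) l.38621): `W80 … ε_C …` can only be
formed AFTER `ε_C` is bound, so a `Wq` quantified before `∃ ε_C` cannot take it — the cut must bind the regime FIRST.  This file is that cut on
the Literature side, per lattice: ONE existential block `∃ b a_C ε_C` carrying the regime, and UNDER IT the W-slot of `W80 … ε_C J Δπ` (§1, any
`J`, `Δπ`) ∕ of (G)'s `W80L … ε_C` at the chain's letters `J := Jcur U`, `Δπ := deltaPiCLM … G′ …` (§2, any `G′`).  It also records that the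
generic carriers of (θ)∕(V₀-letters) (`𝒳`, `H`, `C`) ACCEPT the torus letters (`𝒳 := NegSize (L:ℝ) η levB 0 𝔸`, `HopAd`, `Cc`) in the kernel.

WHAT IS PROVED (sorry-free; no definition; no `Prop` placeholder; nothing of [B11]'s inequalities asserted).
* §1 **`exists_WSlot_sectC`** — for ANY `k_H`, `J`, `Δπ`, under `1 ≤ L`, `α ≤ 1/128`, `hU1`, `hreg`, `1 ≤ lev₀`, `hU` (unitary), `hUn`, `hτ`, `hτs`,
  `hW`, `hW'` ONLY: `∃ b a_C ε_C, 0 ≤ b ∧ 0 < a_C ∧ 0 < ε_C ∧ Regime (HopAd … k_H) 0 (Cc …) b 0 (2097152(d+1)²) (1/(512(d+1))) 0 a_C ε_C ∧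
  ∃ R′ > 0, ∃ C₄ ≥ 0, QuadAnalytic (W80 ρ τ U (HopAd … k_H) (Cc …) ε_C J Δπ) C₄ R′ ∧ AnalyticOnNhd ℂ (W80 …) {‖Y‖ < R′}`.
* §2 **`exists_WSlot_sectC_atLetters`** — the same with (G)'s `W80L L m φ U G′ lev₁ (nabla115 η U) ρ τ (HopAd … k_H) (Cc …) ε_C` (ANY `G′`, `φ`).
* §0 `norm_plaq_word_le_one`, **`traceSlots_of_contractive`** — the trace slots `hW`, `hW'` FROM `‖τ X‖ ≤ ‖X‖` and `‖U(b)‖, ‖U(b)⁻¹‖ ≤ 1` ([folklore]);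
  §3 **`exists_WSlot_sectC_of_contractive`** — §1 with `hW`, `hW'` so discharged: displayed = (31)-window + `hU`, `hUn`, `hτ`, `hτs`, `‖τ‖ ≤ 1`.
HONEST SCOPE.  (i) PER-LATTICE: `b`, `a_C`, `ε_C`, `R′`, `C₄` are numbers of ONE lattice, ONE background, ONE kernel — NO «d and L only», NO (46)
decay, NO (14)∕(38) smallness derived.  (ii) `k_H` ARBITRARY ((L4) identification not made); `hW`∕`hW'`, `hU`, `hτ`, `hτs` are the cell's
normalised-trace ∕ unitarity STRUCTURE, displayed.  (iii) Composition BY NAME of the three lineage files and ne9-leaf-03's PART E; their HONEST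
SCOPES inherited.  (iv) This is the W-SIDE input of a chart cut, NOT the chart: (Ψ1)–(Ψ3), `hpos` ([B9] Thm 3.11) and the J-term placement are
the OWNER's ∕ T23's.  NE9 NOT PRINTED ∕ NOT PROVED; spine 0∕9; finite torus; NOT infinite volume, NOT mass gap, NOT Clay.
-/

namespace Literature.MathematicalPhysics.QuantumFieldTheory.Balaban1983to89.B11Eq98WSlotSectCPerLattice

open B11Eq115Space B11Eq44COperatorTorus
open B11Prop6Scheme (Prop4Hyp)
open B11Eq45HOperator (HopAd)   open B11Eq174Chart (Regime)
open B11Eq111FrakG (nabla115)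
open B9Eq319QprimeTorus (fineP)   open B9SectCLatticeCarrier (Bond)   open B4Sect5Torus (TSite)   open B7Prop1Explicit (U1 Wcx boxVec)
open B9Eq315QTorus (perCfg cornerSite)
open B13Contraction113 (QuadAnalytic)
open B11Eq80Current (W80)
open B9Eq39Adjoint (posPlaq plaqU)
open B11Eq90V0primeCurrent (Tsh Ucur)
open B11Eq90CurrentAtLetters (W80L)
open B11Eq103H1Complex (SiteL2K)
open B11Eq98V0LettersPerLattice (exists_quadAnalytic_W80_structural)
open B11Eq44RegimePerLattice (exists_regime_sectC)

variable {d : ℕ} {𝔸 : Type*} [NormedRing 𝔸] [NormedAlgebra ℂ 𝔸] [CompleteSpace 𝔸] [NormOneClass 𝔸] [FiniteDimensional ℂ 𝔸]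
  [StarRing 𝔸] [StarModule ℂ 𝔸]
  (L : ℕ) (m : Fin d → ℕ) [∀ i, NeZero (fineP L m i)] (η : ℝ) (U : Bond d (fineP L m) → 𝔸ˣ)
  (lev₀ : Bond d (fineP L m) → ℕ) (lev₁ : Bond d (fineP L m) × Fin d → ℕ) (levB : Bond d m → ℕ) [Fact (0 < (L : ℝ))] [Fact (0 < η)]
  (hL : 1 ≤ L) {α : ℝ} (hα : α ≤ 1 / 128)
  (hU1 : ∀ (x : B7Prop1Explicit.Site d) (κ : Fin d), perCfg (fineP L m) U x κ ∈ U1 𝔸)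
  (hreg : ∀ (y : TSite d m) (κ : Fin d) (r : Fin d → Fin L),
    ‖((Wcx L (perCfg (fineP L m) U) (cornerSite L y) κ (boxVec L r) : 𝔸ˣ) : 𝔸) - 1‖ ≤ α)
  (hlev : ∀ b, 1 ≤ lev₀ b)
  (ρ : (𝔸 →L[ℂ] ℂ) →L[ℂ] 𝔸) (τ : 𝔸 →L[ℂ] ℂ)
  (hU : ∀ b, (((U b)⁻¹ : 𝔸ˣ) : 𝔸) = star (U b : 𝔸))
  (hUn : ∀ b, ‖(U b : 𝔸)‖ ≤ 1 ∧ ‖(((U b)⁻¹ : 𝔸ˣ) : 𝔸)‖ ≤ 1)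
  (hτ : ∀ a b : 𝔸, τ (a * b) = τ (b * a)) (hτs : ∀ a : 𝔸, τ (star a) = starRingEnd ℂ (τ a))
  (hW : ∀ q ∈ posPlaq (TSite d (fineP L m)) (Fin d), ∀ Z : 𝔸,
    ‖(τ : 𝔸 →ₗ[ℂ] ℂ) (Z * (plaqU Tsh (Ucur U) q.2.1 q.2.2 q.1 : 𝔸))‖ ≤ ‖Z‖)
  (hW' : ∀ q ∈ posPlaq (TSite d (fineP L m)) (Fin d), ∀ Z : 𝔸,
    ‖(τ : 𝔸 →ₗ[ℂ] ℂ) (Z * (((plaqU Tsh (Ucur U) q.2.1 q.2.2 q.1)⁻¹ : 𝔸ˣ) : 𝔸))‖ ≤ ‖Z‖)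

/-! ## §0 The trace slots `hW`, `hW'` from a contractive trace and a unitary-bounded background -/

omit [NormedAlgebra ℂ 𝔸] [NormOneClass 𝔸] [CompleteSpace 𝔸] [FiniteDimensional ℂ 𝔸] [StarRing 𝔸] [StarModule ℂ 𝔸] in
/-- Units with all four norms `≤ 1` have `‖a·b·c⁻¹·e⁻¹‖ ≤ 1` and `‖(a·b·c⁻¹·e⁻¹)⁻¹‖ ≤ 1` ([folklore]: `norm_mul_le`
three times). [cite: Balaban1985BackgroundPropagators, (3.1) p.390] -/
theorem norm_plaq_word_le_one {a b c e : 𝔸ˣ} (ha : ‖(a : 𝔸)‖ ≤ 1 ∧ ‖((a⁻¹ : 𝔸ˣ) : 𝔸)‖ ≤ 1) (hb : ‖(b : 𝔸)‖ ≤ 1 ∧ ‖((b⁻¹ : 𝔸ˣ) : 𝔸)‖ ≤ 1)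
    (hc : ‖(c : 𝔸)‖ ≤ 1 ∧ ‖((c⁻¹ : 𝔸ˣ) : 𝔸)‖ ≤ 1) (he : ‖(e : 𝔸)‖ ≤ 1 ∧ ‖((e⁻¹ : 𝔸ˣ) : 𝔸)‖ ≤ 1) :
    ‖((a * b * c⁻¹ * e⁻¹ : 𝔸ˣ) : 𝔸)‖ ≤ 1 ∧ ‖(((a * b * c⁻¹ * e⁻¹)⁻¹ : 𝔸ˣ) : 𝔸)‖ ≤ 1 := by
  have key : ∀ x y : 𝔸, ‖x‖ ≤ 1 → ‖y‖ ≤ 1 → ‖x * y‖ ≤ 1 := fun x y hx hy => by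
    nlinarith [norm_mul_le x y, norm_nonneg x, norm_nonneg y]
  constructor
  · simp only [Units.val_mul]
    exact key _ _ (key _ _ (key _ _ ha.1 hb.1) hc.2) he.2
  · simp only [mul_inv_rev, inv_inv, Units.val_mul]
    exact key _ _ he.1 (key _ _ hc.1 (key _ _ hb.2 ha.2))

omit [NormOneClass 𝔸] [CompleteSpace 𝔸] [FiniteDimensional ℂ 𝔸] [StarRing 𝔸] [StarModule ℂ 𝔸] [∀ i, NeZero (fineP L m i)] [Fact (0 < (L : ℝ))] in
/-- **The (31)-type trace slots `hW`, `hW'` of the V₀-group files FROM STRUCTURE**: a norm-contractive trace (`‖τ X‖ ≤ ‖X‖`, e.g. the normalised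
trace of the cell) and a background with `‖U(b)‖, ‖U(b)⁻¹‖ ≤ 1` give `‖τ(Z·U(∂q))‖ ≤ ‖Z‖` and `‖τ(Z·U(∂q)⁻¹)‖ ≤ ‖Z‖` for every plaquette
([folklore]; removes two displayed slots of `exists_quadAnalytic_curV0` ∕ §1 in favour of `‖τ‖ ≤ 1`). [cite: Balaban1985Variational, (31)–(32) p.282, (38) p.284] -/
theorem traceSlots_of_contractive (τ : 𝔸 →L[ℂ] ℂ) (hτ1 : ∀ X : 𝔸, ‖τ X‖ ≤ ‖X‖) (U₀ : Bond d (fineP L m) → 𝔸ˣ)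
    (hUn : ∀ b, ‖(U₀ b : 𝔸)‖ ≤ 1 ∧ ‖(((U₀ b)⁻¹ : 𝔸ˣ) : 𝔸)‖ ≤ 1) :
    (∀ q ∈ posPlaq (TSite d (fineP L m)) (Fin d), ∀ Z : 𝔸,
        ‖(τ : 𝔸 →ₗ[ℂ] ℂ) (Z * (plaqU Tsh (Ucur U₀) q.2.1 q.2.2 q.1 : 𝔸))‖ ≤ ‖Z‖) ∧
      ∀ q ∈ posPlaq (TSite d (fineP L m)) (Fin d), ∀ Z : 𝔸,
        ‖(τ : 𝔸 →ₗ[ℂ] ℂ) (Z * (((plaqU Tsh (Ucur U₀) q.2.1 q.2.2 q.1)⁻¹ : 𝔸ˣ) : 𝔸))‖ ≤ ‖Z‖ := by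
  have hP : ∀ (μ ν : Fin d) (x : TSite d (fineP L m)),
      ‖(plaqU Tsh (Ucur U₀) μ ν x : 𝔸)‖ ≤ 1 ∧ ‖(((plaqU Tsh (Ucur U₀) μ ν x)⁻¹ : 𝔸ˣ) : 𝔸)‖ ≤ 1 := fun μ ν x =>
    norm_plaq_word_le_one (hUn _) (hUn _) (hUn _) (hUn _)
  have hZ : ∀ (Z P : 𝔸), ‖P‖ ≤ 1 → ‖(τ : 𝔸 →ₗ[ℂ] ℂ) (Z * P)‖ ≤ ‖Z‖ := fun Z P hP1 => by
    rw [ContinuousLinearMap.coe_coe]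
    calc ‖τ (Z * P)‖ ≤ ‖Z * P‖ := hτ1 _
      _ ≤ ‖Z‖ * ‖P‖ := norm_mul_le _ _
      _ ≤ ‖Z‖ * 1 := mul_le_mul_of_nonneg_left hP1 (norm_nonneg _)
      _ = ‖Z‖ := mul_one _
  exact ⟨fun q _ Z => hZ Z _ (hP _ _ _).1, fun q _ Z => hZ Z _ (hP _ _ _).2⟩

/-! ## §1 The regime first, then the W-slot of `W80 … ε_C J Δπ` at that `ε_C` -/

include hL hα hU1 hreg hlev hU hUn hτ hτs hW hW' in
/-- **THE (L3) W-SLOT AT THE T-SLOT's OWN `(H, C, ε_C)`, PER LATTICE.**  For ANY kernel `k_H` and ANY letters `J`, `Δπ`: ONE existential block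
binds the Sect. C regime's scalars FIRST (`B11Eq44RegimePerLattice.exists_regime_sectC`), and UNDER IT the `Wq`-slot binders of
`W80 ρ τ U (HopAd … k_H) (Cc …) ε_C J Δπ` hold (`B11Eq98V0LettersPerLattice.exists_quadAnalytic_W80_structural` fed with that regime and ne9-leaf-03's
`prop4Hyp_Cc`) — displayed: the (31)-window (`1 ≤ L`, `α ≤ 1/128`, `hU1`, `hreg`, `1 ≤ lev₀`) and the trace ∕ unitarity structure ONLY.
PER-LATTICE numbers, NOT «d and L only». [cite: Balaban1985Variational, Prop. 3 p.289, Prop. 4 (97)–(98) pp.292–293, (80) p.290] -/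
theorem exists_WSlot_sectC (kH : Bond d (fineP L m) → Bond d m → (𝔸 →L[ℂ] 𝔸)) (J : NegSize (L : ℝ) η lev₀ 3 𝔸)
    (Δπ : Space115 (L : ℝ) η lev₀ lev₁ (nabla115 η U) →L[ℂ] NegSize (L : ℝ) η lev₀ 3 𝔸) :
    ∃ b aC εC : ℝ, 0 ≤ b ∧ 0 < aC ∧ 0 < εC ∧
      Regime (HopAd (L : ℝ) η levB lev₀ lev₁ U kH) 0 (Cc L m η U lev₀ lev₁ (nabla115 η U) levB) b 0
        (2097152 * ((d : ℝ) + 1) ^ 2) (1 / (512 * ((d : ℝ) + 1))) 0 aC εC ∧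
      ∃ R' : ℝ, 0 < R' ∧ ∃ C₄ : ℝ, 0 ≤ C₄ ∧
        QuadAnalytic (W80 ρ τ U (HopAd (L : ℝ) η levB lev₀ lev₁ U kH) (Cc L m η U lev₀ lev₁ (nabla115 η U) levB) εC J Δπ) C₄ R' ∧
        AnalyticOnNhd ℂ (W80 ρ τ U (HopAd (L : ℝ) η levB lev₀ lev₁ U kH) (Cc L m η U lev₀ lev₁ (nabla115 η U) levB) εC J Δπ)
          {Y : Space115 (L : ℝ) η lev₀ lev₁ (nabla115 η U) | ‖Y‖ < R'} := by
  obtain ⟨b, aC, εC, hb, haC, hεC, RC⟩ := exists_regime_sectC L m η U lev₀ lev₁ levB hL hα hU1 hreg hlev kH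
  obtain ⟨R', hR', C₄, hC₄, hq, ha⟩ := exists_quadAnalytic_W80_structural ρ τ U hU hUn hτ hτs (Nat.one_le_cast.mpr hL) hW hW' RC
    (prop4Hyp_Cc L m η U lev₀ lev₁ (nabla115 η U) levB hL hα hU1 hreg hlev) haC J Δπ
  exact ⟨b, aC, εC, hb, haC, hεC, RC, R', hR', C₄, hC₄, hq, ha⟩

/-! ## §2 The same at the chain's letters: (G)'s `W80L` -/

include hL hα hU1 hreg hlev hU hUn hτ hτs hW hW' in
/-- **THE (L3) W AT THE CHAIN's LETTERS, AT THE T-SLOT's OWN `(H, C, ε_C)`, PER LATTICE** — §1 with (G)'s `W80L L m φ U G′ lev₁ (nabla115 η U) ρ τ H C ε_C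
= W80 … (Jcur U) (deltaPiCLM L m φ τ U G′ lev₁ (nabla115 η U))` (by `rfl`), for ANY `G′` and ANY norming equivalence `φ`: the regime FIRST, then
`∃ R′ > 0, ∃ C₄ ≥ 0, QuadAnalytic (W80L … ε_C) C₄ R′ ∧ AnalyticOnNhd …` at that `ε_C`. [cite: Balaban1985Variational, Prop. 4 (97)–(98) pp.292–293, (84)–(90) pp.290–291] -/
theorem exists_WSlot_sectC_atLetters [NeZero L] {W : Type*} [NormedAddCommGroup W] [InnerProductSpace ℂ W] [FiniteDimensional ℂ W]
    (φ : W ≃ₗ[ℂ] 𝔸) {c₀ : ℝ} [Fact (0 < c₀)] (Gp : SiteL2K ℂ d (fineP L m) c₀ W →ₗ[ℂ] SiteL2K ℂ d (fineP L m) c₀ W)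
    (kH : Bond d (fineP L m) → Bond d m → (𝔸 →L[ℂ] 𝔸)) :
    ∃ b aC εC : ℝ, 0 ≤ b ∧ 0 < aC ∧ 0 < εC ∧
      Regime (HopAd (L : ℝ) η levB lev₀ lev₁ U kH) 0 (Cc L m η U lev₀ lev₁ (nabla115 η U) levB) b 0
        (2097152 * ((d : ℝ) + 1) ^ 2) (1 / (512 * ((d : ℝ) + 1))) 0 aC εC ∧
      ∃ R' : ℝ, 0 < R' ∧ ∃ C₄ : ℝ, 0 ≤ C₄ ∧
        QuadAnalytic (W80L L m φ U Gp lev₁ (nabla115 η U) ρ τ (HopAd (L : ℝ) η levB lev₀ lev₁ U kH)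
          (Cc L m η U lev₀ lev₁ (nabla115 η U) levB) εC) C₄ R' ∧
        AnalyticOnNhd ℂ (W80L L m φ U Gp lev₁ (nabla115 η U) ρ τ (HopAd (L : ℝ) η levB lev₀ lev₁ U kH)
          (Cc L m η U lev₀ lev₁ (nabla115 η U) levB) εC) {Y : Space115 (L : ℝ) η lev₀ lev₁ (nabla115 η U) | ‖Y‖ < R'} :=
  exists_WSlot_sectC L m η U lev₀ lev₁ levB hL hα hU1 hreg hlev ρ τ hU hUn hτ hτs hW hW' kH _ _


/-! ## §3 The same with the trace slots discharged by §0 -/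

include hL hα hU1 hreg hlev hU hUn hτ hτs in
/-- **THE (L3) W-SLOT AT THE T-SLOT's OWN `(H, C, ε_C)`, PER LATTICE, FROM THE (31)-WINDOW, UNITARITY AND A CONTRACTIVE TRACIAL `*`-TRACE ONLY** —
§1 with `hW`, `hW'` supplied by §0 from `‖τ X‖ ≤ ‖X‖`. [cite: Balaban1985Variational, Prop. 3 p.289, Prop. 4 (97)–(98) pp.292–293, (31)–(32) p.282] -/
theorem exists_WSlot_sectC_of_contractive (hτ1 : ∀ X : 𝔸, ‖τ X‖ ≤ ‖X‖) (kH : Bond d (fineP L m) → Bond d m → (𝔸 →L[ℂ] 𝔸))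
    (J : NegSize (L : ℝ) η lev₀ 3 𝔸) (Δπ : Space115 (L : ℝ) η lev₀ lev₁ (nabla115 η U) →L[ℂ] NegSize (L : ℝ) η lev₀ 3 𝔸) :
    ∃ b aC εC : ℝ, 0 ≤ b ∧ 0 < aC ∧ 0 < εC ∧
      Regime (HopAd (L : ℝ) η levB lev₀ lev₁ U kH) 0 (Cc L m η U lev₀ lev₁ (nabla115 η U) levB) b 0
        (2097152 * ((d : ℝ) + 1) ^ 2) (1 / (512 * ((d : ℝ) + 1))) 0 aC εC ∧
      ∃ R' : ℝ, 0 < R' ∧ ∃ C₄ : ℝ, 0 ≤ C₄ ∧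
        QuadAnalytic (W80 ρ τ U (HopAd (L : ℝ) η levB lev₀ lev₁ U kH) (Cc L m η U lev₀ lev₁ (nabla115 η U) levB) εC J Δπ) C₄ R' ∧
        AnalyticOnNhd ℂ (W80 ρ τ U (HopAd (L : ℝ) η levB lev₀ lev₁ U kH) (Cc L m η U lev₀ lev₁ (nabla115 η U) levB) εC J Δπ)
          {Y : Space115 (L : ℝ) η lev₀ lev₁ (nabla115 η U) | ‖Y‖ < R'} :=
  have hWW := traceSlots_of_contractive L m τ hτ1 U hUn
  exists_WSlot_sectC L m η U lev₀ lev₁ levB hL hα hU1 hreg hlev ρ τ hU hUn hτ hτs hWW.1 hWW.2 kH J Δπ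

end Literature.MathematicalPhysics.QuantumFieldTheory.Balaban1983to89.B11Eq98WSlotSectCPerLattice
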